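import Mathlib
import HarnessLib
import Summits.ResolutionOfSingularities.ResolutionOfSingularities.Theorems.WildQuotientsWildQuotientResolutionKSCentreEigenline

/-!
# Generators of a stable centre adapted to its stable normal hyperplane
# (Kollár–Szabó going down, (K2-centres); crux `WildQuotients.WildQuotientResolution`, stub `stub_phaseZeroHighDim`)

Crux stmt-ResolutionOfSingularities-15640 (`WildQuotientResolution`), registered stub `stub_phaseZeroHighDim`;
programme PHASE0-KS-EIGENLINE, item (K2-centres). ✓`CentreEigenline.exists_stable_hyperplane` (p830410) gives,
for a residue-trivial abelian / p-closed stabiliser and a stable centre ideal `J ∋` (through the closed point), a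
stable HYPERPLANE `𝔪J ≤ W < J` of the fibre `J/𝔪J`. The monoidal transform `A[J/t]_𝔫` at the fixed point `[W]`
is computed in COORDINATES: a regular system of parameters `x` of `A` of which a sub-family `x ∘ e` generates `J`
(the centre is regular), with `t = x (e i) ∉ W` the chart denominator and the other centre coordinates IN `W`.
This file produces such coordinates from any coordinates of the centre — pure algebra of generating sets in a
local ring, no regularity needed:

* `exists_isUnit_coeff_of_not_mem` — if `t = Σ c_j x_{e j} ∉ W ⊇ 𝔪J` then some `c_i` is a unit;
* ★ `exists_generators_adapted_to_hyperplane` — given `(x) = 𝔪`, `J = (x ∘ e)` (`e` injective), `𝔪J ≤ W ≤ J`,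
  `t ∈ J ∖ W` with `W + (t) = J`: new coordinates `x'` with `(x') = 𝔪`, `(x' ∘ e) = J`, `x' (e i) = t`,
  `x' (e j) ∈ W` for `j ≠ i`, `W ≤ (x' (e j) : j ≠ i) + 𝔪J`, and `x' = x` OFF the centre coordinates
  (so `x'` is again a regular system of parameters when `x` was one: same number of generators of `𝔪`);
* `exists_adapted_generators_of_stable_centre` — packaged with ✓`CentreEigenline.exists_stable_hyperplane` and
  ✓`exists_unit_mul_sub_mem_of_not_mem`: for an ABELIAN residue-trivial stabiliser of a Noetherian local ring with
  algebraically closed residue field and a stable centre `J = (x ∘ e) ≠ 0`, adapted coordinates `x'`, the stable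
  hyperplane `W`, and unit eigenvalues `τ_g t ≡ u_g t (mod W)` — the input block of the equivariant monoidal
  transform (next file; for `J = 𝔪` this is hand 8-g1's ✓`EigenlineChart.exists_rsop_adapted_to_hyperplane`).

[OURS · crux stmt-ResolutionOfSingularities-15640 · helper toward `stub_phaseZeroHighDim` ((K2-centres), coordinates;
NOT a proof of the stub); folklore local algebra, counted 0; AI-level work, weaker than expert review.] [folklore]
-/

-- single-problem summit: the doubled namespace component `ResolutionOfSingularities` is forced
set_option linter.dupNamespace false

namespace Summit.ResolutionOfSingularities.ResolutionOfSingularities.Theorems.WildQuotientResolution.CentreEigenline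

open IsLocalRing
open Summit.ResolutionOfSingularities.ResolutionOfSingularities.Theorems.WildQuotientResolution

variable {A : Type*} [CommRing A] [IsLocalRing A]

/-- **A transversal element has a unit coefficient.** If `t = Σ c_j y_j` lies outside an ideal `W ⊇ 𝔪·(y)`, then
some coefficient `c_i` is a unit. [folklore] -/
theorem exists_isUnit_coeff_of_not_mem {m : ℕ} (y : Fin m → A) (W : Ideal A)
    (hWJ : maximalIdeal A * Ideal.span (Set.range y) ≤ W) (c : Fin m → A) {t : A}
    (hc : ∑ j, c j * y j = t) (htW : t ∉ W) : ∃ i, IsUnit (c i) := by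
  by_contra h
  push Not at h
  apply htW
  rw [← hc]
  refine Ideal.sum_mem _ fun j _ => hWJ (Ideal.mul_mem_mul ?_ (Ideal.subset_span ⟨j, rfl⟩))
  exact (IsLocalRing.mem_maximalIdeal _).mpr (mem_nonunits_iff.mpr (h j))

/-- **Generators of the centre adapted to a hyperplane of its fibre.** Let `(A, 𝔪)` be local, `x : Fin d → A` with
`(x) = 𝔪`, `e : Fin m → Fin d` injective, `J = (x ∘ e)`, and `W` an ideal with `𝔪J ≤ W ≤ J`, `t ∈ J ∖ W`,
`W + (t) = J` (a hyperplane of `J/𝔪J` and a transversal). Then there are `x' : Fin d → A` and `i : Fin m` with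
`(x') = 𝔪`, `(x' ∘ e) = J`, `x' (e i) = t`, `x' (e j) ∈ W` for `j ≠ i`, `W ≤ (x' (e j) : j ≠ i) + 𝔪J`, and
`x' k = x k` for `k ∉ range e`. (Write `t = Σ c_j x_{e j}` with `c_i` a unit; put `x'_{e i} := t` and
`x'_{e j} := x_{e j} − b_j t ∈ W`.) [folklore] -/
theorem exists_generators_adapted_to_hyperplane {d m : ℕ} (x : Fin d → A)
    (hx : Ideal.span (Set.range x) = maximalIdeal A) (e : Fin m → Fin d) (he : Function.Injective e)
    (W : Ideal A) (hWJ : maximalIdeal A * Ideal.span (Set.range (x ∘ e)) ≤ W)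
    (hWle : W ≤ Ideal.span (Set.range (x ∘ e))) {t : A} (ht : t ∈ Ideal.span (Set.range (x ∘ e)))
    (htW : t ∉ W) (hsup : W ⊔ Ideal.span {t} = Ideal.span (Set.range (x ∘ e))) :
    ∃ (x' : Fin d → A) (i : Fin m), Ideal.span (Set.range x') = maximalIdeal A ∧
      Ideal.span (Set.range (x' ∘ e)) = Ideal.span (Set.range (x ∘ e)) ∧ x' (e i) = t ∧
      (∀ j : Fin m, j ≠ i → x' (e j) ∈ W) ∧
      W ≤ Ideal.span ((x' ∘ e) '' {j | j ≠ i}) ⊔ maximalIdeal A * Ideal.span (Set.range (x ∘ e)) ∧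
      ∀ k : Fin d, k ∉ Set.range e → x' k = x k := by
  classical
  set J : Ideal A := Ideal.span (Set.range (x ∘ e)) with hJ
  have hxm : ∀ k, x k ∈ maximalIdeal A := fun k => hx ▸ Ideal.subset_span ⟨k, rfl⟩
  have hJm : J ≤ maximalIdeal A := Ideal.span_le.mpr (by rintro _ ⟨j, rfl⟩; exact hxm (e j))
  have hxeJ : ∀ j, x (e j) ∈ J := fun j => Ideal.subset_span ⟨j, rfl⟩
  -- Step 1: `t = Σ c_j x_{e j}` with `c_i` a unit
  obtain ⟨c, hc⟩ := Ideal.mem_span_range_iff_exists_fun.mp ht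
  obtain ⟨i, hi⟩ := exists_isUnit_coeff_of_not_mem (x ∘ e) W hWJ c hc htW
  obtain ⟨u, hu⟩ := hi
  -- Step 2: `x_{e j} = w_j + b_j t`
  have hdec : ∀ j : Fin m, ∃ b : A, x (e j) - b * t ∈ W := by
    intro j
    have h := hxeJ j
    rw [← hsup] at h
    obtain ⟨w, hw, s, hs, hws⟩ := Submodule.mem_sup.mp h
    obtain ⟨b, rfl⟩ := Ideal.mem_span_singleton'.mp hs
    exact ⟨b, by rw [← hws]; simpa using hw⟩
  choose b hb using hdec
  -- the new centre coordinates (kept opaque)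
  obtain ⟨y, hyi, hyj⟩ : ∃ y : Fin m → A, y i = t ∧ ∀ j, j ≠ i → y j = x (e j) - b j * t :=
    ⟨fun j => if j = i then t else x (e j) - b j * t, by simp, fun j hj => by simp [hj]⟩
  have hyW : ∀ j, j ≠ i → y j ∈ W := fun j hj => by rw [hyj j hj]; exact hb j
  have hyJ : ∀ j, y j ∈ J := by
    intro j
    by_cases hj : j = i
    · subst hj; rw [hyi]; exact ht
    · rw [hyj j hj]; exact sub_mem (hxeJ j) (J.mul_mem_left _ ht)
  -- Step 3: `(y) = J`
  have hty : t ∈ Ideal.span (Set.range y) := hyi ▸ Ideal.subset_span ⟨i, rfl⟩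
  have hxey : ∀ j, x (e j) ∈ Ideal.span (Set.range y) := by
    -- first the `j ≠ i`
    have hne : ∀ j, j ≠ i → x (e j) ∈ Ideal.span (Set.range y) := by
      intro j hj
      have e1 : x (e j) = y j + b j * t := by rw [hyj j hj]; ring
      rw [e1]
      exact add_mem (Ideal.subset_span ⟨j, rfl⟩) (Ideal.mul_mem_left _ _ hty)
    intro j
    by_cases hj : j = i
    · subst hj
      -- `c_j x_{e j} = t - Σ_{k ≠ j} c_k x_{e k}`
      have hsplit : c j * x (e j) = t - ∑ k ∈ Finset.univ.erase j, c k * x (e k) := by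
        rw [← hc, ← Finset.add_sum_erase _ _ (Finset.mem_univ j)]
        simp only [Function.comp_apply]
        ring
      have hrest : ∑ k ∈ Finset.univ.erase j, c k * x (e k) ∈ Ideal.span (Set.range y) :=
        Ideal.sum_mem _ fun k hk => Ideal.mul_mem_left _ _ (hne k (Finset.ne_of_mem_erase hk))
      have e2 : x (e j) = ↑u⁻¹ * (c j * x (e j)) := by
        rw [← mul_assoc, ← hu, Units.inv_mul, one_mul]
      rw [e2, hsplit]
      exact Ideal.mul_mem_left _ _ (sub_mem hty hrest)
    · exact hne j hj
  have hspan_y : Ideal.span (Set.range y) = J := by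
    apply le_antisymm
    · exact Ideal.span_le.mpr (by rintro _ ⟨j, rfl⟩; exact hyJ j)
    · exact Ideal.span_le.mpr (by rintro _ ⟨j, rfl⟩; exact hxey j)
  -- Step 4: the full family (kept opaque): `x'` extends `y` along `e` and agrees with `x` elsewhere
  obtain ⟨x', hx'e, hx'off⟩ : ∃ x' : Fin d → A, (∀ j, x' (e j) = y j) ∧ ∀ k, k ∉ Set.range e → x' k = x k :=
    ⟨Function.extend e y x, fun j => he.extend_apply y x j,
      fun k hk => Function.extend_apply' y x k (fun ⟨j, hj⟩ => hk ⟨j, hj⟩)⟩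
  have hx'e' : x' ∘ e = y := funext hx'e
  refine ⟨x', i, ?_, by rw [hx'e', hspan_y], by rw [hx'e, hyi], fun j hj => by rw [hx'e]; exact hyW j hj,
    ?_, hx'off⟩
  · -- `(x') = 𝔪`
    apply le_antisymm
    · refine Ideal.span_le.mpr ?_
      rintro _ ⟨k, rfl⟩
      by_cases h : ∃ j, e j = k
      · obtain ⟨j, rfl⟩ := h
        rw [hx'e]
        exact hJm (hyJ j)
      · rw [hx'off k (by rintro ⟨j, rfl⟩; exact h ⟨j, rfl⟩)]
        exact hxm k
    · have hxx' : ∀ k, x k ∈ Ideal.span (Set.range x') := by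
        intro k
        by_cases h : ∃ j, e j = k
        · obtain ⟨j, rfl⟩ := h
          have h1 : x (e j) ∈ Ideal.span (Set.range y) := hxey j
          have h3 : Set.range y ⊆ Set.range x' := by
            rintro _ ⟨j', rfl⟩
            exact ⟨e j', hx'e j'⟩
          exact Ideal.span_mono h3 h1
        · have h2 : x k = x' k := (hx'off k (by rintro ⟨j, rfl⟩; exact h ⟨j, rfl⟩)).symm
          rw [h2]
          exact Ideal.subset_span ⟨k, rfl⟩
      calc maximalIdeal A = Ideal.span (Set.range x) := hx.symm
        _ ≤ Ideal.span (Set.range x') := Ideal.span_le.mpr (by rintro _ ⟨k, rfl⟩; exact hxx' k)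
  · -- `W ≤ (x'_{e j} : j ≠ i) + 𝔪J`
    intro w hw
    have hwJ : w ∈ Ideal.span (Set.range y) := hspan_y ▸ hWle hw
    obtain ⟨a, ha⟩ := Ideal.mem_span_range_iff_exists_fun.mp hwJ
    set S' : A := ∑ k ∈ Finset.univ.erase i, a k * y k with hS'
    have hsplit : w = a i * t + S' := by
      rw [← ha, ← Finset.add_sum_erase _ _ (Finset.mem_univ i), hyi]
    have hS'W : S' ∈ W :=
      Ideal.sum_mem _ fun k hk => Ideal.mul_mem_left _ _ (hyW k (Finset.ne_of_mem_erase hk))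
    have hS'span : S' ∈ Ideal.span ((x' ∘ e) '' {j | j ≠ i}) :=
      Ideal.sum_mem _ fun k hk => Ideal.mul_mem_left _ _
        (Ideal.subset_span ⟨k, Finset.ne_of_mem_erase hk, by rw [Function.comp_apply, hx'e]⟩)
    have hait : a i * t ∈ W := by
      have e1 : a i * t = w - S' := by rw [hsplit]; ring
      rw [e1]
      exact sub_mem hw hS'W
    -- `a_i` is not a unit, else `t ∈ W`
    have hai : a i ∈ maximalIdeal A := by
      refine (IsLocalRing.mem_maximalIdeal _).mpr (mem_nonunits_iff.mpr fun hunit => htW ?_)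
      obtain ⟨v, hv⟩ := hunit
      have e1 : t = ↑v⁻¹ * (a i * t) := by rw [← mul_assoc, ← hv, Units.inv_mul, one_mul]
      rw [e1]
      exact Ideal.mul_mem_left _ _ hait
    rw [hsplit, add_comm]
    exact Submodule.add_mem_sup hS'span (Ideal.mul_mem_mul hai ht)

/-- **Adapted coordinates for an ABELIAN stabiliser of a stable centre** — the input block of the equivariant
monoidal transform. Let `(A, 𝔪, κ)` be Noetherian local with `κ` algebraically closed, `τ` a residue-trivial action of
an abelian group `I`, `x : Fin d → A` with `(x) = 𝔪`, `e` injective with `J = (x ∘ e) ≠ 0` stable under `τ`. Then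
there are coordinates `x'` (`(x') = 𝔪`, `x' = x` off `range e`, `(x' ∘ e) = J`), an index `i` with
`t := x' (e i)`, and a `τ`-STABLE ideal `W` with `𝔪J ≤ W ≤ J`, `x' (e j) ∈ W` (`j ≠ i`),
`W ≤ (x' (e j) : j ≠ i) + 𝔪J`, `t ∉ W`, and unit eigenvalues `τ_g t − u_g t ∈ W`.
[cite: ReichsteinYoussin2000, Appendix, proof of Prop. A.2] -/
theorem exists_adapted_generators_of_stable_centre [IsNoetherianRing A] [IsAlgClosed (ResidueField A)]
    {I : Type*} [CommGroup I] (τ : I →* (A ≃+* A)) (hres : ∀ (g : I) (a : A), τ g a - a ∈ maximalIdeal A)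
    {d m : ℕ} (x : Fin d → A) (hx : Ideal.span (Set.range x) = maximalIdeal A)
    (e : Fin m → Fin d) (he : Function.Injective e)
    (hJ0 : Ideal.span (Set.range (x ∘ e)) ≠ ⊥)
    (hJ : ∀ g : I, ∀ a ∈ Ideal.span (Set.range (x ∘ e)), τ g a ∈ Ideal.span (Set.range (x ∘ e))) :
    ∃ (x' : Fin d → A) (i : Fin m) (W : Ideal A), Ideal.span (Set.range x') = maximalIdeal A ∧
      Ideal.span (Set.range (x' ∘ e)) = Ideal.span (Set.range (x ∘ e)) ∧
      (∀ k : Fin d, k ∉ Set.range e → x' k = x k) ∧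
      maximalIdeal A * Ideal.span (Set.range (x ∘ e)) ≤ W ∧ W ≤ Ideal.span (Set.range (x ∘ e)) ∧
      x' (e i) ∉ W ∧ (∀ j : Fin m, j ≠ i → x' (e j) ∈ W) ∧
      W ≤ Ideal.span ((x' ∘ e) '' {j | j ≠ i}) ⊔ maximalIdeal A * Ideal.span (Set.range (x ∘ e)) ∧
      (∀ g : I, ∀ w ∈ W, τ g w ∈ W) ∧
      ∀ g : I, ∃ u : A, IsUnit u ∧ τ g (x' (e i)) - u * x' (e i) ∈ W := by
  set J : Ideal A := Ideal.span (Set.range (x ∘ e)) with hJdef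
  obtain ⟨W, hWJ, hWle, hWne, hsup, hstab⟩ := exists_stable_hyperplane τ hres J hJ0 hJ
  obtain ⟨t, htJ, htW⟩ : ∃ t ∈ J, t ∉ W := SetLike.exists_of_lt (lt_of_le_of_ne hWle hWne)
  obtain ⟨x', i, hx', hx'J, hx'i, hx'W, hWle', hx'off⟩ :=
    exists_generators_adapted_to_hyperplane x hx e he W hWJ hWle htJ htW (hsup t htJ htW)
  refine ⟨x', i, W, hx', hx'J, hx'off, hWJ, hWle, by rw [hx'i]; exact htW, hx'W, hWle', hstab, fun g => ?_⟩
  rw [hx'i]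
  exact exists_unit_mul_sub_mem_of_not_mem τ J hJ W hWJ hstab htJ htW (hsup t htJ htW) g

end Summit.ResolutionOfSingularities.ResolutionOfSingularities.Theorems.WildQuotientResolution.CentreEigenline
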